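import Literature.NumberTheory.Sieve.HeathBrownCubicPrimes
import Literature.NumberTheory.Sieve.BatemanHornProofs
import Mathlib.RingTheory.Polynomial.Eisenstein.Basic
import HarnessLib

/-!
# Discharge of `HeathBrown2001_singularProduct`: Heath-Brown's `σ₀` converges and is positive

Companion ("Proofs") file of `Literature.NumberTheory.Sieve.HeathBrownCubicPrimes` (kept separate
so that the statements file keeps its imports to `ParityWave0` + `BatemanHorn`). It PROVES the
named fact `Literature.NumberTheory.Sieve.CubicPrimes.HeathBrown2001_singularProduct` — the ordered partial products
`∏_{p < N} (1 − (ν_p − 1)/p)` of the singular product `σ₀` in Heath-Brown's theorem on primes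
`x³ + 2y³` (Acta Math. 186 (2001), p. 2: "the product `σ₀` is conditionally convergent, but not
absolutely convergent"; proved there on p. 37, (6.7)) tend to a positive limit — as
`HeathBrown2001_singularProduct_holds`, so users holding `(h : HeathBrown2001_singularProduct)`
are fed `_holds`.

## Proof

Heath-Brown (p. 37) gets `∑_{Y < p ≤ Z} (ν_p − 1)/p ≪ (log Y)^{−2}` from the prime number
theorem and the prime ideal theorem with error terms. Plain convergence of `∑_p (ν_p − 1)/p`
suffices for the convergence of the product, and that is already PROVED in the tree for the root
count of any monic irreducible `g ∈ ℤ[X]` (`Literature.NumberTheory.Sieve.AZFG2020_lemma_5_3_5_holds`,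
`Sieve/BatemanHornProofs.lean`, resting on `LFunctions/DegreeOnePrimes.lean`: Dedekind–Kummer,
the residue of `ζ_K` at `s = 1`, and the Hardy–Littlewood Tauberian theorem for prime sums).
We take `g = X³ − 2` (irreducible by Eisenstein at `2`, `irreducible_X_pow_three_sub_C_two`),
transport along the bridge `cubeRootTwoCount_eq_polyRootCountMod` (`ν_p = ω_g(p)`), and finish
as in Bateman–Horn 1962, p. 365: with `a_p = (ν_p − 1)/p ∈ [−1/p, 2/p]` one has
`|log(1 − a_p) + a_p| ≤ 2a_p² ≤ 8/p²` for `p ≥ 5`, so `log ∏_{p<N} (1 − a_p) =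
−∑_{p<N} a_p + ∑_{p<N} O(1/p²)` converges and the partial products tend to `exp` of the limit,
which is positive.

## Content (namespace `Literature.CubicPrimes`)

* `irreducible_X_pow_three_sub_C_two` — `X³ − 2 ∈ ℤ[X]` is irreducible. [folklore]
* `exists_tendsto_sum_cubeRootTwoCount_sub_one_div` — `∑_{p<N} (ν_p − 1)/p` converges.
* `HeathBrown2001_singularProduct_holds : HeathBrown2001_singularProduct`.

## References

* D. R. Heath-Brown, *Primes represented by `x³ + 2y³`*, Acta Math. 186 (2001) 1–84
  (`HeathBrownActa2001`), p. 2 and p. 37 (6.7).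
* P. T. Bateman, R. A. Horn, Math. Comp. 16 (1962), pp. 364–365 (`BatemanHornMathComp1962`).
* S. L. Aletheia-Zomlefer, L. Fukshansky, S. R. Garcia, Expo. Math. 38 (2020), Lemma 5.3.5
  (`AletheiaZomleferFukshanskyGarcia2020`).
-/

noncomputable section

open Filter Finset Polynomial Topology

namespace Literature.NumberTheory.Sieve.CubicPrimes

/-- `X³ − 2 ∈ ℤ[X]` is irreducible (Eisenstein at `2`). [folklore] -/
theorem irreducible_X_pow_three_sub_C_two : Irreducible (X ^ 3 - C 2 : ℤ[X]) := by
  have hmonic : (X ^ 3 - C 2 : ℤ[X]).Monic := monic_X_pow_sub_C 2 three_ne_zero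
  have hdeg : (X ^ 3 - C 2 : ℤ[X]).natDegree = 3 := natDegree_X_pow_sub_C
  have hprime : (Ideal.span {(2 : ℤ)}).IsPrime :=
    (Ideal.span_singleton_prime two_ne_zero).2 Int.prime_two
  have hE : (X ^ 3 - C 2 : ℤ[X]).IsEisensteinAt (Ideal.span {(2 : ℤ)}) := by
    refine ⟨?_, ?_, ?_⟩
    · rw [hmonic.leadingCoeff, Ideal.mem_span_singleton]; norm_num
    · intro n hn
      rw [hdeg] at hn
      rw [Ideal.mem_span_singleton, coeff_sub, coeff_X_pow, coeff_C]
      interval_cases n <;> simp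
    · rw [Ideal.span_singleton_pow, Ideal.mem_span_singleton, coeff_sub, coeff_X_pow, coeff_C]
      norm_num
  exact hE.irreducible hprime hmonic.isPrimitive (by rw [hdeg]; norm_num)

/-- **`∑_p (ν_p − 1)/p` converges** (ordered partial sums over `p < N`, `N → ∞`): the case
`g = X³ − 2` of Aletheia-Zomlefer–Fukshansky–Garcia 2020, Lemma 5.3.5 / Bateman–Horn 1962,
p. 364 (PROVED in the tree, `Literature.NumberTheory.Sieve.AZFG2020_lemma_5_3_5_holds`, from Dedekind–Kummer, the residue
of `ζ_K` and a Tauberian theorem), transported along the bridge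
`cubeRootTwoCount_eq_polyRootCountMod`. Heath-Brown (p. 37) obtains the sharper
`∑_{Y < p ≤ Z} (ν_p − 1)/p ≪ (log Y)^{−2}` from the prime number theorem and the prime ideal
theorem with error terms; plain convergence is all that `σ₀` needs.
[cite: HeathBrownActa2001, p. 37 (6.7)] -/
theorem exists_tendsto_sum_cubeRootTwoCount_sub_one_div :
    ∃ L : ℝ, Tendsto (fun N : ℕ => ∑ p ∈ Nat.primesBelow N, ((cubeRootTwoCount p : ℝ) - 1) / p)
      atTop (𝓝 L) := by
  obtain ⟨L, hL⟩ := AZFG2020_lemma_5_3_5_holds (X ^ 3 - C 2) (monic_X_pow_sub_C 2 three_ne_zero)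
    irreducible_X_pow_three_sub_C_two
  refine ⟨L, ?_⟩
  have h : (fun N : ℕ => ∑ p ∈ Nat.primesBelow N, ((cubeRootTwoCount p : ℝ) - 1) / p) =
      (fun x : ℕ => ∑ p ∈ Nat.primesLE x,
        ((polyRootCountMod ![(X ^ 3 - C 2 : ℤ[X])] p : ℝ) - 1) / p) ∘ fun N : ℕ => N - 1 := by
    funext N
    simp only [Function.comp_apply, Nat.primesBelow_eq_primesLE_sub_one,
      cubeRootTwoCount_eq_polyRootCountMod]
  rw [h]
  exact hL.comp (tendsto_sub_atTop_nat 1)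

/-- **Discharge of `HeathBrown2001_singularProduct`**: the ordered partial products
`∏_{p < N} (1 − (ν_p − 1)/p)` of Heath-Brown's `σ₀` converge to a positive limit. Proof: with
`a_p = (ν_p − 1)/p ∈ [−1/p, 2/p]`, `log(1 − a_p) = −a_p + O(1/p²)` (`|log(1 − x) + x| ≤ 2x²` for
`|x| ≤ 1/2`), `∑_p a_p` converges (`exists_tendsto_sum_cubeRootTwoCount_sub_one_div`) and the
`O(1/p²)` terms are absolutely summable, so the partial products are `exp` of a convergent
sequence. [cite: HeathBrownActa2001, p. 2 and (6.7) p. 37] -/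
theorem HeathBrown2001_singularProduct_holds : HeathBrown2001_singularProduct := by
  classical
  obtain ⟨L, hL⟩ := exists_tendsto_sum_cubeRootTwoCount_sub_one_div
  set a : ℕ → ℝ := fun p => ((cubeRootTwoCount p : ℝ) - 1) / p with ha
  -- the factors are positive
  have hfac : ∀ p : ℕ, p.Prime → 0 < 1 - a p := by
    intro p hp
    have hp0 : (0 : ℝ) < p := by exact_mod_cast hp.pos
    have hle : (cubeRootTwoCount p : ℝ) ≤ p := by exact_mod_cast cubeRootTwoCount_le p
    rw [ha]
    dsimp only
    rw [sub_pos, div_lt_one hp0]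
    linarith
  -- `t p = log(1 − a_p) + a_p = O(1/p²)`
  set t : ℕ → ℝ := fun p => Real.log (1 - a p) + a p with ht
  have ht_bound : ∀ p : ℕ, p.Prime → 5 ≤ p → |t p| ≤ 8 / (p : ℝ) ^ 2 := by
    intro p hp h5
    have hp5 : (5 : ℝ) ≤ p := by exact_mod_cast h5
    have hp0 : (0 : ℝ) < p := by linarith
    have hν3 : (cubeRootTwoCount p : ℝ) ≤ 3 := by exact_mod_cast cubeRootTwoCount_le_three hp
    have hν0 : (0 : ℝ) ≤ cubeRootTwoCount p := Nat.cast_nonneg _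
    have habs : |a p| ≤ 2 / p := by
      rw [ha]
      dsimp only
      rw [abs_div, abs_of_pos hp0, div_le_div_iff_of_pos_right hp0, abs_le]
      constructor <;> linarith
    have h2p : (2 : ℝ) / p ≤ 1 / 2 := by
      rw [div_le_div_iff₀ hp0 two_pos]; linarith
    have habs' : |a p| ≤ 1 / 2 := habs.trans h2p
    have h := Real.abs_log_sub_add_sum_range_le (x := a p) (by linarith) 1
    rw [Finset.sum_range_one] at h
    norm_num at h
    calc |t p| = |a p + Real.log (1 - a p)| := by rw [ht]; dsimp only; rw [add_comm]
      _ ≤ a p ^ 2 / (1 - |a p|) := h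
      _ ≤ 2 * a p ^ 2 := by
          rw [div_le_iff₀ (by linarith)]
          nlinarith [mul_nonneg (sq_nonneg (a p)) (by linarith : (0 : ℝ) ≤ 1 - 2 * |a p|)]
      _ = 2 * |a p| ^ 2 := by rw [sq_abs]
      _ ≤ 2 * (2 / p) ^ 2 := by gcongr
      _ = 8 / (p : ℝ) ^ 2 := by ring
  -- hence `t` (extended by `0` off the primes) is summable and its prime partial sums converge
  set g : ℕ → ℝ := fun n => if n.Prime then t n else 0 with hg
  have hg_sum : Summable g := by
    refine Summable.of_norm_bounded_eventually_nat (g := fun n => 8 / (n : ℝ) ^ 2) ?_ ?_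
    · simpa [div_eq_mul_one_div (8 : ℝ)] using
        (Real.summable_one_div_nat_pow.mpr one_lt_two).mul_left 8
    · rw [eventually_atTop]
      refine ⟨5, fun n hn => ?_⟩
      rw [hg]
      dsimp only
      split_ifs with hn'
      · rw [Real.norm_eq_abs]
        exact ht_bound n hn' hn
      · rw [norm_zero]
        positivity
  have hT : Tendsto (fun N : ℕ => ∑ p ∈ Nat.primesBelow N, t p) atTop (𝓝 (∑' n, g n)) := by
    have h1 : (fun N : ℕ => ∑ p ∈ Nat.primesBelow N, t p) = fun N => ∑ n ∈ range N, g n := by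
      funext N
      simp only [Nat.primesBelow_eq_filter_range, Finset.sum_filter, hg]
    rw [h1]
    exact hg_sum.hasSum.tendsto_sum_nat
  -- the partial product is `exp (∑_{p<N} t p − ∑_{p<N} a p)`
  have hexp : ∀ N, singularProductPartial N =
      Real.exp (∑ p ∈ Nat.primesBelow N, t p - ∑ p ∈ Nat.primesBelow N, a p) := by
    intro N
    rw [← Finset.sum_sub_distrib]
    simp only [ht, add_sub_cancel_right]
    rw [Real.exp_sum, singularProductPartial_def]
    refine Finset.prod_congr rfl fun p hp => ?_
    rw [Real.exp_log (hfac p (Nat.prime_of_mem_primesBelow hp))]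
  refine ⟨Real.exp (∑' n, g n - L), Real.exp_pos _, ?_⟩
  rw [show singularProductPartial = _ from funext hexp]
  exact (Real.continuous_exp.tendsto _).comp (hT.sub hL)

end Literature.NumberTheory.Sieve.CubicPrimes

end
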